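/-
Origin: expansion seat `planner-pub-hodgecm-qw8-g10-0`, handover #1 (md5 696d4ea02249, 384 l.): NEW additive leaf; imports ONLY Mathlib + run-30 tree `HodgeCM.Model.Toy.LefNormalPartner`, `HodgeCM.Model.Toy.LefClosureExclusive`; no rewrite; any order; frozen copy handover/LefNonGenReal.696d4ea02249.lean (`HOME/pub-hodgecm-qw8-g10/lean/Qw8g10/LefNonGenReal.lean`, md5 696d4ea0, 384 lines);
landed by the gen-8 packager in gate run 31 as `HodgeCM/Model/Toy/LefNonGenReal.lean` (verbatim).
-/
-- HANDOVER (planner-pub-hodgecm-qw8-g10-0, unit pub-hodgecm-qw8-g10): WIP module `Qw8g10.LefNonGenReal`; intended final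
-- module `HodgeCM.Model.Toy.LefNonGenReal` (kind L5, separating model); NEW additive leaf; imports ONLY Mathlib + the
-- RUN-30 tree modules `HodgeCM.Model.Toy.LefNormalPartner`, `HodgeCM.Model.Toy.LefClosureExclusive` — no rewrite needed.
/-
Copyright (c) 2026. All rights reserved.
Released under Apache 2.0 license as described in the file LICENSE.
-/
import Mathlib
import Summits.HodgeConjecture.HodgeCM.Model.Toy.LefNormalPartner
import Summits.HodgeConjecture.HodgeCM.Model.Toy.LefClosureExclusive

/-!
# `NonGenReal` decided: quartic CM fields, cyclic `2`-power Galois groups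

`LefPartialConjGalois` / `LefClosureExclusive` / `LefNormalPartner` put the mixing criterion `PartialConj K₁ K₂` of
the separating model `lefModel` (`LefPartialConj`: for CM fields of degree `≤ 4` it is EQUIVALENT to HC for all
products of CM objects presented over `K₁` and `K₂`) in Galois-closed form, under the per-field hypothesis
`NonGenReal K` (every non-generator `y`, `ℚ(y) ≠ K`, is totally real) or its failure — hypotheses those files leave
undecided.  This file DECIDES `NonGenReal` structurally:

* `nonGenReal_of_isCyclic`: a number field Galois over `ℚ` with CYCLIC group of order `2^k` has `NonGenReal` (the
  unique involution of the group lies in every nontrivial subgroup, so complex conjugation fixes every proper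
  subfield) — imaginary quadratic fields, `ℚ(ζ₅)`, `ℚ(ζ₁₇)`, ….
* **Quartic CM fields, completely: `nonGenReal_iff_isCyclic (hK : [K:ℚ] = 4) : NonGenReal K ↔ IsCyclic (K ≃ₐ[ℚ] K)`**,
  i.e. `NonGenReal` iff `K` is NOT biquadratic.  Pieces: `nonGenReal_of_not_normal` (a non-normal quartic CM field has
  `K⁺` as its only quadratic subfield — a second one would make `K` a compositum of quadratic, hence normal, fields);
  `not_nonGenReal_of_not_isCyclic` (a Klein four-group has an involution `τ ≠` conjugation, whose quadratic fixed field
  is not fixed by conjugation); `isCyclic_aut_of_not_normal` (`|Aut_ℚ(L)| ∣ 2` for a non-normal quartic `L`);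
  `normal_of_not_nonGenReal`.
* Hence the qw8-g9 theorems with their hypotheses DISCHARGED: the quartic mixing theorem
  `partialConj_iff_galClosure_ne_of_isCyclic (hᵢ : [Kᵢ:ℚ] ≤ 4) [IsCyclic Aut_ℚ(Kᵢ)] : PartialConj K₁ K₂ ↔
  galClosure K₁ ≠ galClosure K₂`, its hypothesis-free `D₄ × D₄` case `partialConj_iff_galClosure_ne_of_not_normal`,
  the biquadratic-partner criterion without a normality instance `partialConj_iff_of_not_nonGenReal_quartic`, and the
  `lefModel.HC` headlines `lef_hc_prod_of_presented_of_isCyclic`, `lef_hc_cmObj_prod_cmObj_of_isCyclic`,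
  `lef_hc_cmObj_prod_cmObj_of_not_normal`, `lef_hc_prodFin_cmObj_of_isCyclic`.
  Net, with `LefNormalPartner.partialConj_iff_of_biquadratic` and `PartialConj.symm`: `PartialConj` is decided for
  EVERY pair of CM fields of degree `≤ 4` — both `Aut` cyclic: the closures differ; one biquadratic: none of its
  elements of degree `≤ 2` takes a non-real value in the other closure.

Kernel-checked from Mathlib (`IsCMField.complexConj` as the tree's `HodgeCM.conjAlgEquiv`, the Galois correspondence
`IntermediateField.fixedField` / `finrank_fixedField_eq_card` / `IsGalois.of_card_aut_eq_finrank`,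
`Algebra.IsQuadraticExtension.normal`, `IntermediateField.normal_sup`, Cauchy's theorem).  Nothing is cited; no data.
Concrete instances (cyclotomic fields) are in `LefExamples`.
-/

noncomputable section

set_option backward.isDefEq.respectTransparency false

namespace HodgeCM.Toy

open Literature.AlgebraicGeometry.Motives (CMType)
open NumberField.ComplexEmbedding (conjugate)

/-! ### 1. Cyclic Galois groups of `2`-power order -/

section NonGen

/-- a finite cyclic group has at most one involution -/
theorem eq_of_orderOf_eq_two {G : Type*} [Group G] [Finite G] [IsCyclic G] {x y : G}
    (hx : orderOf x = 2) (hy : orderOf y = 2) : x = y := by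
  classical
  letI := Fintype.ofFinite G
  by_contra hne
  have hx1 : x ≠ 1 := fun h => by rw [h, orderOf_one] at hx; exact absurd hx (by norm_num)
  have hy1 : y ≠ 1 := fun h => by rw [h, orderOf_one] at hy; exact absurd hy (by norm_num)
  have hsub : ({1, x, y} : Finset G) ⊆ Finset.univ.filter (fun a : G => a ^ 2 = 1) := by
    intro a ha
    simp only [Finset.mem_insert, Finset.mem_singleton] at ha
    simp only [Finset.mem_filter, Finset.mem_univ, true_and]
    rcases ha with rfl | rfl | rfl
    · exact one_pow 2
    · rw [← hx]; exact pow_orderOf_eq_one _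
    · rw [← hy]; exact pow_orderOf_eq_one _
  have hcard : ({1, x, y} : Finset G).card = 3 := by
    rw [Finset.card_insert_of_notMem (by simp [hx1.symm, hy1.symm]), Finset.card_pair hne]
  have := (Finset.card_le_card hsub).trans (IsCyclic.card_pow_eq_one_le (α := G) (by norm_num : 0 < 2))
  omega

variable {K : Type} [Field K] [NumberField K]

/-- **Cyclic `2`-power Galois groups.** A number field Galois over `ℚ` with cyclic group of order `2^k` has
`NonGenReal`: complex conjugation (for any embedding) is the unique involution of the group, hence lies in every
nontrivial subgroup, hence fixes every proper subfield. Covers imaginary quadratic fields, `ℚ(ζ₅)`, `ℚ(ζ₁₇)`, …. -/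
theorem nonGenReal_of_isCyclic [IsGalois ℚ K] [IsCyclic (K ≃ₐ[ℚ] K)] {k : ℕ}
    (hK : Module.finrank ℚ K = 2 ^ k) : NonGenReal K := by
  classical
  intro y hy b
  obtain ⟨σ, hσ'⟩ := NumberField.ComplexEmbedding.exists_comp_symm_eq_of_comp_eq (k := ℚ) b (conjugate b)
    (Subsingleton.elim _ _)
  have hσ : NumberField.ComplexEmbedding.IsConj b σ.symm := hσ'.symm
  have key : b (σ.symm y) = star (b y) := hσ.eq y
  by_cases h1 : σ.symm = 1
  · rw [h1, AlgEquiv.one_apply] at key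
    rw [starRingEnd_apply]
    exact key.symm
  · have hord : orderOf σ.symm = 2 := NumberField.ComplexEmbedding.orderOf_isConj_two_of_ne_one hσ h1
    set E : IntermediateField ℚ K := IntermediateField.adjoin ℚ {y} with hE
    have hH : E.fixingSubgroup ≠ ⊥ := by
      intro h
      apply hy
      have h' := IsGalois.fixedField_fixingSubgroup E
      rw [h, IntermediateField.fixedField_bot] at h'
      exact h'.symm
    have hG : Nat.card (K ≃ₐ[ℚ] K) = 2 ^ k := by rw [IsGalois.card_aut_eq_finrank, hK]
    have hdvd : Nat.card E.fixingSubgroup ∣ 2 ^ k := hG ▸ Subgroup.card_subgroup_dvd_card _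
    obtain ⟨j, -, hj⟩ := (Nat.dvd_prime_pow Nat.prime_two).mp hdvd
    have hj0 : j ≠ 0 := by
      rintro rfl
      rw [pow_zero] at hj
      exact hH (Subgroup.eq_bot_of_card_eq _ hj)
    have h2 : 2 ∣ Nat.card E.fixingSubgroup := by rw [hj]; exact dvd_pow_self 2 hj0
    haveI : Fact (Nat.Prime 2) := ⟨Nat.prime_two⟩
    obtain ⟨x, hx⟩ := exists_prime_orderOf_dvd_card' (G := E.fixingSubgroup) 2 h2
    have hx' : orderOf (x : K ≃ₐ[ℚ] K) = 2 := by rw [Subgroup.orderOf_coe]; exact hx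
    have hxσ : (x : K ≃ₐ[ℚ] K) = σ.symm := eq_of_orderOf_eq_two hx' hord
    have hmem : σ.symm ∈ E.fixingSubgroup := hxσ ▸ x.2
    rw [IntermediateField.mem_fixingSubgroup_iff] at hmem
    rw [hmem y (IntermediateField.mem_adjoin_simple_self ℚ y)] at key
    rw [starRingEnd_apply]
    exact key.symm

end NonGen

/-! ### 2. Quartic CM fields: `NonGenReal` iff not biquadratic iff `Aut_ℚ(K)` is cyclic -/

section Quartic

variable (K : CMField)

/-! Complex conjugation of the CM field `K` as a `ℚ`-algebra automorphism is the tree's `HodgeCM.conjAlgEquiv K`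
(`HodgeCM.StubTree.Qw8`, from Mathlib's `IsCMField.complexConj`). -/

/-- (Ported verbatim from the HodgeCMPerL package; no docstring in the source.) -/
theorem apply_conjAlgEquiv (b : K →+* ℂ) (x : K) : b (conjAlgEquiv K x) = starRingEnd ℂ (b x) :=
  NumberField.IsCMField.complexEmbedding_complexConj K b x

/-- (Ported verbatim from the HodgeCMPerL package; no docstring in the source.) -/
theorem conjAlgEquiv_conjAlgEquiv (x : K) : conjAlgEquiv K (conjAlgEquiv K x) = x :=
  NumberField.IsCMField.complexConj_apply_apply K x

/-- (Ported verbatim from the HodgeCMPerL package; no docstring in the source.) -/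
theorem conjAlgEquiv_ne_one : conjAlgEquiv K ≠ 1 := by
  obtain ⟨b⟩ := (inferInstance : Nonempty (K →+* ℂ))
  intro h
  apply conjugate_ne_self_cm K b
  ext x
  rw [NumberField.ComplexEmbedding.conjugate_coe_eq, ← apply_conjAlgEquiv, h, AlgEquiv.one_apply]

/-- (Ported verbatim from the HodgeCMPerL package; no docstring in the source.) -/
theorem orderOf_conjAlgEquiv : orderOf (conjAlgEquiv K) = 2 :=
  orderOf_eq_prime_iff.mpr
    ⟨by ext x; rw [pow_two, AlgEquiv.mul_apply, AlgEquiv.one_apply, conjAlgEquiv_conjAlgEquiv], conjAlgEquiv_ne_one K⟩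

/-- `K⁺` as an intermediate field: the fixed field of complex conjugation -/
abbrev realSub : IntermediateField ℚ K := IntermediateField.fixedField (Subgroup.zpowers (conjAlgEquiv K))

variable {K}

/-- (Ported verbatim from the HodgeCMPerL package; no docstring in the source.) -/
theorem conjAlgEquiv_eq_self_of_mem_realSub {x : K} (hx : x ∈ realSub K) : conjAlgEquiv K x = x :=
  (IntermediateField.mem_fixedField_iff _ x).mp hx _ (Subgroup.mem_zpowers _)

/-- (Ported verbatim from the HodgeCMPerL package; no docstring in the source.) -/
theorem finrank_realSub_mul_two : Module.finrank ℚ (realSub K) * 2 = Module.finrank ℚ K := by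
  have h := IntermediateField.finrank_fixedField_eq_card (F := ℚ) (E := K) (Subgroup.zpowers (conjAlgEquiv K))
  rw [Nat.card_zpowers, orderOf_conjAlgEquiv] at h
  rw [← h]
  exact Module.finrank_mul_finrank ℚ (realSub K) K

/-- `NonGenReal` of a CM field in terms of complex conjugation: every non-generator is fixed by `conjAlgEquiv` -/
theorem nonGenReal_iff_conjAlgEquiv : NonGenReal K ↔ ∀ y : K, IntermediateField.adjoin ℚ {y} ≠ ⊤ → conjAlgEquiv K y = y := by
  refine forall_congr' fun y => imp_congr_right fun _ => ⟨fun h => ?_, fun h b => ?_⟩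
  · obtain ⟨b⟩ := (inferInstance : Nonempty (K →+* ℂ))
    apply b.injective
    rw [apply_conjAlgEquiv]
    exact h b
  · rw [← apply_conjAlgEquiv, h]

/-- (Ported verbatim from the HodgeCMPerL package; no docstring in the source.) -/
theorem normal_of_finrank_intermediateField_eq_two {L : Type} [Field L] [NumberField L]
    {E : IntermediateField ℚ L} (h : Module.finrank ℚ E = 2) : Normal ℚ E :=
  haveI : Algebra.IsQuadraticExtension ℚ E := { finrank_eq_two' := h }
  inferInstance

/-- **Non-normal quartic CM fields have `NonGenReal`.** The only quadratic subfield of such a field is `K⁺`: a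
second one would present `K` as the compositum of two quadratic — hence normal — subfields, making `K` normal. -/
theorem nonGenReal_of_not_normal (hK : Module.finrank ℚ K = 4) (hn : ¬ Normal ℚ K) : NonGenReal K := by
  rw [nonGenReal_iff_conjAlgEquiv]
  intro y hy
  by_contra hσy
  set E : IntermediateField ℚ K := IntermediateField.adjoin ℚ {y} with hE
  have htop : Module.finrank ℚ (⊤ : IntermediateField ℚ K) = 4 :=
    (IntermediateField.finrank_top' (F := ℚ) (E := K)).trans hK
  have hdvd : Module.finrank ℚ E ∣ 4 := htop ▸ IntermediateField.finrank_dvd_of_le_right le_top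
  have hE1 : Module.finrank ℚ E ≠ 1 := by
    intro h1
    rw [IntermediateField.finrank_eq_one_iff] at h1
    have hy' : y ∈ (⊥ : IntermediateField ℚ K) := h1 ▸ IntermediateField.mem_adjoin_simple_self ℚ y
    rw [IntermediateField.mem_bot] at hy'
    obtain ⟨q, rfl⟩ := hy'
    exact hσy (AlgEquiv.commutes _ q)
  have hE4 : Module.finrank ℚ E ≠ 4 := fun h4 =>
    hy (IntermediateField.eq_of_le_of_finrank_eq le_top (h4.trans htop.symm))
  have hE2 : Module.finrank ℚ E = 2 := by
    have hle : Module.finrank ℚ E ≤ 4 := Nat.le_of_dvd (by norm_num) hdvd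
    obtain ⟨d, hd⟩ : ∃ d, Module.finrank ℚ E = d := ⟨_, rfl⟩
    rw [hd] at hdvd hE1 hE4 hle ⊢
    interval_cases d <;> omega
  have hR2 : Module.finrank ℚ (realSub K) = 2 := by
    have := finrank_realSub_mul_two (K := K); omega
  have hyR : y ∉ realSub K := fun h => hσy (conjAlgEquiv_eq_self_of_mem_realSub h)
  have hER : E ≠ realSub K := fun h => hyR (h ▸ IntermediateField.mem_adjoin_simple_self ℚ y)
  have hsup : E ⊔ realSub K = ⊤ := by
    have h1 : Module.finrank ℚ ↥(E ⊔ realSub K) ∣ 4 := htop ▸ IntermediateField.finrank_dvd_of_le_right le_top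
    have h2 : 2 ∣ Module.finrank ℚ ↥(E ⊔ realSub K) := hE2 ▸ IntermediateField.finrank_dvd_of_le_right le_sup_left
    have h3 : Module.finrank ℚ ↥(E ⊔ realSub K) ≠ 2 := by
      intro h3
      apply hER
      rw [IntermediateField.eq_of_le_of_finrank_eq le_sup_left (hE2.trans h3.symm)]
      exact (IntermediateField.eq_of_le_of_finrank_eq le_sup_right (hR2.trans h3.symm)).symm
    have h4 : Module.finrank ℚ ↥(E ⊔ realSub K) = 4 := by
      have hle := Nat.le_of_dvd (by norm_num) h1
      have hpos : 0 < Module.finrank ℚ ↥(E ⊔ realSub K) := Module.finrank_pos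
      omega
    exact IntermediateField.eq_of_le_of_finrank_eq le_top (h4.trans htop.symm)
  haveI : Normal ℚ E := normal_of_finrank_intermediateField_eq_two hE2
  haveI : Normal ℚ (realSub K) := normal_of_finrank_intermediateField_eq_two hR2
  have hN : Normal ℚ ↥(E ⊔ realSub K) := inferInstance
  rw [hsup] at hN
  exact hn (Normal.of_algEquiv (IntermediateField.topEquiv (F := ℚ) (E := K)))

/-- **Biquadratic CM fields fail `NonGenReal`.** A normal quartic CM field whose Galois group is not cyclic has an
automorphism `τ ∉ {1, conjugation}`; its fixed field is a quadratic subfield not fixed by conjugation. -/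
theorem not_nonGenReal_of_not_isCyclic [Normal ℚ K] (hK : Module.finrank ℚ K = 4)
    (hc : ¬ IsCyclic ((K : Type) ≃ₐ[ℚ] K)) : ¬ NonGenReal K := by
  rw [nonGenReal_iff_conjAlgEquiv]
  intro h
  haveI : IsGalois ℚ K := ⟨⟩
  have hcard : Nat.card ((K : Type) ≃ₐ[ℚ] K) = 4 := by rw [IsGalois.card_aut_eq_finrank, hK]
  have hlt : Subgroup.zpowers (conjAlgEquiv K) ≠ ⊤ := by
    intro ht
    have h2 := Nat.card_zpowers (conjAlgEquiv K)
    rw [ht, orderOf_conjAlgEquiv, Subgroup.card_top, hcard] at h2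
    omega
  obtain ⟨τ, hτ⟩ : ∃ τ : (K : Type) ≃ₐ[ℚ] K, τ ∉ Subgroup.zpowers (conjAlgEquiv K) := by
    by_contra! hall
    exact hlt (eq_top_iff.mpr fun τ _ => hall τ)
  have hτ1 : τ ≠ 1 := fun h1 => hτ (h1 ▸ one_mem _)
  have hτσ : τ ≠ conjAlgEquiv K := fun h1 => hτ (h1 ▸ Subgroup.mem_zpowers _)
  have hτ2 : orderOf τ = 2 := by
    have hdvd : orderOf τ ∣ 4 := hcard ▸ orderOf_dvd_natCard τ
    have h1 : orderOf τ ≠ 1 := by rwa [Ne, orderOf_eq_one_iff]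
    have h4 : orderOf τ ≠ 4 := fun h4 => hc (isCyclic_of_orderOf_eq_card τ (h4.trans hcard.symm))
    have hpos : 0 < orderOf τ := (isOfFinOrder_of_finite τ).orderOf_pos
    have hle : orderOf τ ≤ 4 := Nat.le_of_dvd (by norm_num) hdvd
    obtain ⟨d, hd⟩ : ∃ d, orderOf τ = d := ⟨_, rfl⟩
    rw [hd] at hdvd h1 h4 hpos hle ⊢
    interval_cases d <;> omega
  set F : IntermediateField ℚ K := IntermediateField.fixedField (Subgroup.zpowers τ) with hF
  have hF2 : Module.finrank F K = 2 := by
    rw [hF, IntermediateField.finrank_fixedField_eq_card, Nat.card_zpowers, hτ2]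
  have hFtop : F ≠ ⊤ := by
    intro ht
    have h1 : Module.finrank (⊤ : IntermediateField ℚ K) K = 1 := IntermediateField.finrank_top
    rw [← ht, hF2] at h1
    omega
  have hσF : conjAlgEquiv K ∈ F.fixingSubgroup := by
    rw [IntermediateField.mem_fixingSubgroup_iff]
    intro x hx
    apply h x
    intro hxt
    apply hFtop
    exact top_le_iff.mp (hxt ▸ IntermediateField.adjoin_simple_le_iff.mpr hx)
  rw [hF, IntermediateField.fixingSubgroup_fixedField] at hσF
  obtain ⟨k, hk⟩ := Subgroup.mem_zpowers_iff.mp hσF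
  rw [← zpow_mod_orderOf, hτ2] at hk
  push_cast at hk
  rcases Int.emod_two_eq_zero_or_one k with h0 | h1
  · rw [h0, zpow_zero] at hk
    exact conjAlgEquiv_ne_one K hk.symm
  · rw [h1, zpow_one] at hk
    exact hτσ hk

/-- for a normal quartic CM field: `NonGenReal` iff the Galois group is cyclic (`C₄`, not `C₂ × C₂`) -/
theorem nonGenReal_iff_isCyclic_of_normal [Normal ℚ K] (hK : Module.finrank ℚ K = 4) :
    NonGenReal K ↔ IsCyclic ((K : Type) ≃ₐ[ℚ] K) := by
  refine ⟨fun h => by_contra fun hc => not_nonGenReal_of_not_isCyclic hK hc h, fun hc => ?_⟩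
  haveI : IsGalois ℚ K := ⟨⟩
  exact nonGenReal_of_isCyclic (k := 2) (by rw [hK]; norm_num)

/-- a quartic number field that is not normal has `|Aut_ℚ(K)| ∣ 2`; in particular `Aut_ℚ(K)` is cyclic -/
theorem isCyclic_aut_of_not_normal {L : Type} [Field L] [NumberField L] (hL : Module.finrank ℚ L = 4)
    (hn : ¬ Normal ℚ L) : IsCyclic (L ≃ₐ[ℚ] L) := by
  have h1 : Module.finrank ↥(IntermediateField.fixedField (⊤ : Subgroup (L ≃ₐ[ℚ] L))) L =
      Nat.card (L ≃ₐ[ℚ] L) := by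
    rw [IntermediateField.finrank_fixedField_eq_card, Subgroup.card_top]
  have hdvd : Nat.card (L ≃ₐ[ℚ] L) ∣ 4 := by
    rw [← hL, ← h1]
    exact Dvd.intro_left _ (Module.finrank_mul_finrank ℚ _ L)
  have hne : Nat.card (L ≃ₐ[ℚ] L) ≠ 4 := fun h4 => by
    haveI := IsGalois.of_card_aut_eq_finrank (F := ℚ) (E := L) (h4.trans hL.symm)
    exact hn inferInstance
  have hpos : 0 < Nat.card (L ≃ₐ[ℚ] L) := Nat.card_pos
  have h2 : Nat.card (L ≃ₐ[ℚ] L) ∣ 2 := by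
    have hle := Nat.le_of_dvd (by norm_num) hdvd
    obtain ⟨d, hd⟩ : ∃ d, Nat.card (L ≃ₐ[ℚ] L) = d := ⟨_, rfl⟩
    rw [hd] at hdvd hne hpos hle ⊢
    interval_cases d <;> omega
  exact isCyclic_of_card_dvd_prime h2

/-- **`NonGenReal` decided for quartic CM fields: it holds iff `Aut_ℚ(K)` is cyclic**, i.e. iff `K` is NOT
biquadratic (a non-normal quartic CM field has `Aut_ℚ(K) = {1, conjugation}`; a normal one has `NonGenReal` iff its
group is `C₄`). -/
theorem nonGenReal_iff_isCyclic (hK : Module.finrank ℚ K = 4) : NonGenReal K ↔ IsCyclic ((K : Type) ≃ₐ[ℚ] K) := by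
  by_cases hn : Normal ℚ K
  · exact nonGenReal_iff_isCyclic_of_normal hK
  · exact ⟨fun _ => isCyclic_aut_of_not_normal hK hn, fun _ => nonGenReal_of_not_normal hK hn⟩

/-- CM fields of degree `≤ 4` with cyclic `Aut_ℚ(K)` — imaginary quadratic, cyclic quartic, non-normal quartic —
have `NonGenReal` -/
theorem nonGenReal_of_isCyclic_aut (K : CMField) (hd : Module.finrank ℚ K ≤ 4) [hc : IsCyclic ((K : Type) ≃ₐ[ℚ] K)] :
    NonGenReal K := by
  rcases finrank_eq_two_or_four K hd with h | h
  · exact nonGenReal_of_finrank_eq_two K h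
  · exact (nonGenReal_iff_isCyclic h).mpr hc

/-- a quartic CM field failing `NonGenReal` is normal — indeed biquadratic (`nonGenReal_iff_isCyclic`) -/
theorem normal_of_not_nonGenReal (hK : Module.finrank ℚ K = 4) (hng : ¬ NonGenReal K) : Normal ℚ K := by
  by_contra hn
  exact hng (nonGenReal_of_not_normal hK hn)

/-- … so the biquadratic-partner criterion `LefNormalPartner.partialConj_iff_of_biquadratic` needs no normality
hypothesis: a quartic CM field `K` failing `NonGenReal` mixes with a number field `K₁` iff no element of `K` of degree
`≤ 2` takes a non-real value inside `galClosure K₁`.  With `partialConj_iff_galClosure_ne_of_isCyclic` (both fields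
`NonGenReal`) and the symmetry of `PartialConj`, this DECIDES `PartialConj` for every pair of CM fields of degree `≤ 4`
in closed field-theoretic terms. -/
theorem partialConj_iff_of_not_nonGenReal_quartic {K₁ : Type} [Field K₁] [NumberField K₁]
    (hK : Module.finrank ℚ K = 4) (hng : ¬ NonGenReal K) (b : K →+* ℂ) :
    PartialConj K₁ K ↔ ∀ y : K, Module.finrank ℚ ↥(IntermediateField.adjoin ℚ {y}) ≤ 2 →
      liftK b y ∈ galClosure K₁ → starRingEnd ℂ (b y) = b y := by
  haveI := normal_of_not_nonGenReal hK hng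
  exact partialConj_iff_of_biquadratic hK hng b

variable (K₁ K₂ : CMField)

/-- **THE QUARTIC MIXING THEOREM with decided hypotheses.** Two CM fields of degree `≤ 4` with cyclic `Aut_ℚ`
(equivalently: neither is biquadratic) have a partial conjugation iff their Galois closures in `ℚ̄` differ. -/
theorem partialConj_iff_galClosure_ne_of_isCyclic (h₁ : Module.finrank ℚ K₁ ≤ 4) (h₂ : Module.finrank ℚ K₂ ≤ 4)
    [IsCyclic ((K₁ : Type) ≃ₐ[ℚ] K₁)] [IsCyclic ((K₂ : Type) ≃ₐ[ℚ] K₂)] :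
    PartialConj K₁ K₂ ↔ galClosure K₁ ≠ galClosure K₂ :=
  partialConj_iff_galClosure_ne K₁ K₂ h₁ h₂ (nonGenReal_of_isCyclic_aut K₁ h₁) (nonGenReal_of_isCyclic_aut K₂ h₂)

/-- **The `D₄ × D₄` case, unconditionally**: two non-normal quartic CM fields mix iff their Galois closures differ
(same closure: conjugate fields, or a field and its reflex sister). -/
theorem partialConj_iff_galClosure_ne_of_not_normal (h₁ : Module.finrank ℚ K₁ = 4) (h₂ : Module.finrank ℚ K₂ = 4)
    (hn₁ : ¬ Normal ℚ K₁) (hn₂ : ¬ Normal ℚ K₂) : PartialConj K₁ K₂ ↔ galClosure K₁ ≠ galClosure K₂ :=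
  partialConj_iff_galClosure_ne K₁ K₂ h₁.le h₂.le (nonGenReal_of_not_normal h₁ hn₁) (nonGenReal_of_not_normal h₂ hn₂)

/-- **HEADLINE.** Products over two CM fields of degree `≤ 4` with cyclic `Aut_ℚ` and different Galois closures
satisfy HC in `lefModel` — the hypothesis `NonGenReal` of `LefClosureExclusive` discharged. -/
theorem lef_hc_prod_of_presented_of_isCyclic (h₁ : Module.finrank ℚ K₁ ≤ 4) (h₂ : Module.finrank ℚ K₂ ≤ 4)
    [IsCyclic ((K₁ : Type) ≃ₐ[ℚ] K₁)] [IsCyclic ((K₂ : Type) ≃ₐ[ℚ] K₂)] (hne : galClosure K₁ ≠ galClosure K₂)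
    {X Y : Obj} (hX : X.Presented K₁) (hY : Y.Presented K₂) : lefModel.HC (X.prod Y) :=
  lef_hc_prod_of_presented_of_galClosure_ne K₁ K₂ h₁ h₂ (nonGenReal_of_isCyclic_aut K₁ h₁)
    (nonGenReal_of_isCyclic_aut K₂ h₂) hne hX hY

/-- (Ported verbatim from the HodgeCMPerL package; no docstring in the source.) -/
theorem lef_hc_cmObj_prod_cmObj_of_isCyclic (h₁ : Module.finrank ℚ K₁ ≤ 4) (h₂ : Module.finrank ℚ K₂ ≤ 4)
    [IsCyclic ((K₁ : Type) ≃ₐ[ℚ] K₁)] [IsCyclic ((K₂ : Type) ≃ₐ[ℚ] K₂)] (hne : galClosure K₁ ≠ galClosure K₂)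
    (Φ : CMType K₁) (Φ' : CMType K₂) : lefModel.HC ((cmObj K₁ Φ).prod (cmObj K₂ Φ')) :=
  lef_hc_cmObj_prod_cmObj_of_galClosure_ne K₁ K₂ h₁ h₂ (nonGenReal_of_isCyclic_aut K₁ h₁)
    (nonGenReal_of_isCyclic_aut K₂ h₂) hne Φ Φ'

/-- **HEADLINE (`D₄ × D₄`).** Products over two non-normal quartic CM fields with different Galois closures. -/
theorem lef_hc_cmObj_prod_cmObj_of_not_normal (h₁ : Module.finrank ℚ K₁ = 4) (h₂ : Module.finrank ℚ K₂ = 4)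
    (hn₁ : ¬ Normal ℚ K₁) (hn₂ : ¬ Normal ℚ K₂) (hne : galClosure K₁ ≠ galClosure K₂)
    (Φ : CMType K₁) (Φ' : CMType K₂) : lefModel.HC ((cmObj K₁ Φ).prod (cmObj K₂ Φ')) :=
  lef_hc_cmObj_prod_cmObj_of_galClosure_ne K₁ K₂ h₁.le h₂.le (nonGenReal_of_not_normal h₁ hn₁)
    (nonGenReal_of_not_normal h₂ hn₂) hne Φ Φ'

/-- family form -/
theorem lef_hc_prodFin_cmObj_of_isCyclic {ι : Type} (Ks : ι → CMField)
    (hd : ∀ a, Module.finrank ℚ (Ks a) ≤ 4) (hc : ∀ a, IsCyclic ((Ks a : Type) ≃ₐ[ℚ] (Ks a)))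
    (h : ∀ a b, a ≠ b → galClosure (Ks a) ≠ galClosure (Ks b))
    {n : ℕ} (c : Fin (n + 1) → ι) (Θ : ∀ j, CMType (Ks (c j))) :
    lefModel.HC (lefModel.prodFin n fun j => cmObj (Ks (c j)) (Θ j)) :=
  lef_hc_prodFin_cmObj_of_galClosure_ne Ks hd (fun a => @nonGenReal_of_isCyclic_aut (Ks a) (hd a) (hc a)) h c Θ

end Quartic

end HodgeCM.Toy
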